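import Summits.AtomisticToContinuum.Crystallization.Theorems.SquareWellLayerCakeStackingFaultSparsityOffBoxDefs

/-!
# `StackingFaultSparsity` (stmt-AtomisticToContinuum-14296), line `Sketch`: soundness of the interval
checker, part A — the rational certified bounds dominate the layer sums (stub `stub_offBoxGrid`, lead)

Given the per-layer certification of the line (the statement of the registered stub
`stub_offBoxLayerCert`, taken here as the hypothesis `LayerCert`), the rational data of the kernel checker
`obCheck` of `…OffBoxDefs.lean` bound the real layer sums: at a grid value `c = p/10⁴`,
`layerSum 3 (k c) 1 ≤ obHi3N p k`, `obLo6N p k ≤ layerSum 6 (k c) 1`, `obLo3A p k ≤ layerSum 3 (k c/2) 2 ≤ obHi3A p k`,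
`obLo6A p k ≤ layerSum 6 (k c/2) 2 ≤ obHi6A p k`, `layerSum 3 c 0 ≤ obT3hi`, `obT6lo ≤ layerSum 6 c 0`; and on a
grid interval `c ∈ [p₁, p₂]/10⁴` the aggregates satisfy `offBoxB 12 c ≤ obBhi p₁ p₂` and
`obAlo p₁ p₂ ≤ offBoxA 12 c` (layer sums are antitone in the height, `min`/`max` are monotone, the far
tails are antitone in `c`).  All `[folklore]` bookkeeping; no numerics is evaluated here.
-/

noncomputable section

namespace Summit.AtomisticToContinuum.Crystallization.Theorems.SquareWellLayerCake.StackingFaultSparsity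

open Summit.AtomisticToContinuum.Crystallization.Theorems.ExcessDecayLiouvilleCoarseGrains
open Finset

/-! ## Casts of the rational twins -/

/-- `layerTailQ` is `layerTail` over `ℚ`. [folklore] -/
theorem cast_layerTailQ (e K : ℕ) (t : ℚ) : ((layerTailQ e K t : ℚ) : ℝ) = layerTail e K (t : ℝ) := by
  unfold layerTailQ layerTail
  push_cast
  ring

/-- `farTail3Q` is `farTail3` over `ℚ`. [folklore] -/
theorem cast_farTail3Q (K : ℕ) (c : ℚ) : ((farTail3Q K c : ℚ) : ℝ) = farTail3 K (c : ℝ) := by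
  unfold farTail3Q farTail3
  push_cast
  ring

/-- `farTail6Q` is `farTail6` over `ℚ`. [folklore] -/
theorem cast_farTail6Q (K : ℕ) (c : ℚ) : ((farTail6Q K c : ℚ) : ℝ) = farTail6 K (c : ℝ) := by
  unfold farTail6Q farTail6
  push_cast
  ring

/-- The layer aggregate `obBsum` is a `Finset.Icc` sum over the layers `2, …, n + 1`. [folklore] -/
theorem obBsum_eq (p₁ p₂ : ℕ) : ∀ n : ℕ, obBsum p₁ p₂ n =
    ∑ k ∈ Icc 2 (n + 1), max (obHi3A p₁ k) (2 * obHi3N p₁ k - obLo3A p₂ k)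
  | 0 => by simp [obBsum]
  | n + 1 => by
      rw [obBsum, obBsum_eq p₁ p₂ n, Finset.sum_Icc_succ_top (by omega : 2 ≤ n + 1 + 1)]

/-- The layer aggregate `obAsum` is a `Finset.Icc` sum over the layers `2, …, n + 1`. [folklore] -/
theorem obAsum_eq (p₁ p₂ : ℕ) : ∀ n : ℕ, obAsum p₁ p₂ n =
    ∑ k ∈ Icc 2 (n + 1), min (obLo6A p₂ k) (2 * obLo6N p₂ k - obHi6A p₁ k)
  | 0 => by simp [obAsum]
  | n + 1 => by
      rw [obAsum, obAsum_eq p₁ p₂ n, Finset.sum_Icc_succ_top (by omega : 2 ≤ n + 1 + 1)]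

/-- The twelve-layer instance of `obBsum_eq`. [folklore] -/
theorem obBsum_eq_twelve (p₁ p₂ : ℕ) : obBsum p₁ p₂ 11 =
    ∑ k ∈ Icc 2 12, max (obHi3A p₁ k) (2 * obHi3N p₁ k - obLo3A p₂ k) :=
  obBsum_eq p₁ p₂ 11

/-- The twelve-layer instance of `obAsum_eq`. [folklore] -/
theorem obAsum_eq_twelve (p₁ p₂ : ℕ) : obAsum p₁ p₂ 11 =
    ∑ k ∈ Icc 2 12, min (obLo6A p₂ k) (2 * obLo6N p₂ k - obHi6A p₁ k) :=
  obAsum_eq p₁ p₂ 11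

/-! ## Elementary facts on the layer sums -/

/-- The in-layer family does not depend on the ratio: `hcpSumTerm e c (0, i, j) = hcpSumTerm e 1 (0, i, j)`.
[folklore] -/
theorem hcpSumTerm_inLayer (e : ℕ) (c : ℝ) (i j : ℤ) :
    hcpSumTerm e c (0, i, j) = hcpSumTerm e 1 (0, i, j) := by
  unfold hcpSumTerm
  simp

/-- Hence `layerSum e c 0 = layerSum e 1 0` (the registered sub-goal carrying this file). [folklore] -/
theorem layerSum_inLayer : ∀ (e : ℕ) (c : ℝ), layerSum e c 0 = layerSum e 1 0 := by
  intro e c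
  unfold layerSum
  exact tsum_congr fun ij => hcpSumTerm_inLayer e c ij.1 ij.2

/-- `farTail3` is antitone in `c > 0`. [folklore] -/
theorem farTail3_anti {K : ℕ} (hK : 1 ≤ K) {c₁ c : ℝ} (h₁ : 0 < c₁) (h : c₁ ≤ c) :
    farTail3 K c ≤ farTail3 K c₁ := by
  unfold farTail3
  have hK' : (1 : ℝ) ≤ K := by exact_mod_cast hK
  have hc : 0 < c := h₁.trans_le h
  have h6 : c₁ ^ 6 ≤ c ^ 6 := pow_le_pow_left₀ h₁.le h 6
  have h4 : c₁ ^ 4 ≤ c ^ 4 := pow_le_pow_left₀ h₁.le h 4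
  gcongr

/-- `farTail6` is antitone in `c > 0`. [folklore] -/
theorem farTail6_anti {K : ℕ} (hK : 1 ≤ K) {c₁ c : ℝ} (h₁ : 0 < c₁) (h : c₁ ≤ c) :
    farTail6 K c ≤ farTail6 K c₁ := by
  unfold farTail6
  have hK' : (1 : ℝ) ≤ K := by exact_mod_cast hK
  have hc : 0 < c := h₁.trans_le h
  have h12 : c₁ ^ 12 ≤ c ^ 12 := pow_le_pow_left₀ h₁.le h 12
  have h10 : c₁ ^ 10 ≤ c ^ 10 := pow_le_pow_left₀ h₁.le h 10
  gcongr

/-! ## The certified per-layer bounds at a grid point -/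

section Cert

variable (hLC :
    (∀ (e p q K M kk : ℕ), 0 < p → 0 < q → 0 < M →
      (3 * (q : ℝ) ^ 2) ^ e * (hcpSumLoopI p q K e M kk (2 * K + 1) : ℝ) / M ≤
          ∑ ij ∈ layerSquare K, hcpSumTerm e ((p : ℝ) / q) ((kk : ℤ) - K, ij.1, ij.2) ∧
      ∑ ij ∈ layerSquare K, hcpSumTerm e ((p : ℝ) / q) ((kk : ℤ) - K, ij.1, ij.2) ≤
          (3 * (q : ℝ) ^ 2) ^ e * ((hcpSumLoopI p q K e M kk (2 * K + 1) : ℝ) + (2 * K + 1) ^ 2) / M) ∧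
    (∀ (e : ℕ), 3 ≤ e → ∀ (c : ℝ), 0 < c → ∀ (k : ℤ),
      Summable (fun ij : ℤ × ℤ => hcpSumTerm e c (k, ij.1, ij.2)) ∧
      (∀ K : ℕ, 1 ≤ K →
        ∑ ij ∈ layerSquare K, hcpSumTerm e c (k, ij.1, ij.2) ≤ layerSum e c k ∧
        layerSum e c k ≤ ∑ ij ∈ layerSquare K, hcpSumTerm e c (k, ij.1, ij.2) + layerTail e K ((k : ℝ) * c)) ∧
      (∀ c' : ℝ, c ≤ c' → layerSum e c' k ≤ layerSum e c k)))
include hLC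

/-- **Upper certificate of a layer** (general grid form): for `e ≥ 3`, `c = p/q > 0`, layer `k' = kk - K`,
`layerSum e (p/q) k' ≤ (3q²)ᵉ (FS + (2K+1)²)/M + layerTail e K (k' p/q)`. [folklore] -/
theorem layerSum_le_cert {e p q K M kk : ℕ} {k' : ℤ} (he : 3 ≤ e) (hp : 0 < p) (hq : 0 < q)
    (hK : 1 ≤ K) (hM : 0 < M) (hk' : (kk : ℤ) - K = k') :
    layerSum e ((p : ℝ) / q) k' ≤
      (3 * (q : ℝ) ^ 2) ^ e * ((hcpSumLoopI p q K e M kk (2 * K + 1) : ℝ) + (2 * K + 1) ^ 2) / M +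
        layerTail e K ((k' : ℝ) * ((p : ℝ) / q)) := by
  have hc : (0 : ℝ) < (p : ℝ) / q := by positivity
  have h1 := (hLC.1 e p q K M kk hp hq hM).2
  have h2 := ((hLC.2 e he _ hc k').2.1 K hK).2
  rw [hk'] at h1
  linarith

/-- **Lower certificate of a layer** (general grid form): `(3q²)ᵉ FS/M ≤ layerSum e (p/q) k'`. [folklore] -/
theorem cert_le_layerSum {e p q K M kk : ℕ} {k' : ℤ} (he : 3 ≤ e) (hp : 0 < p) (hq : 0 < q)
    (hK : 1 ≤ K) (hM : 0 < M) (hk' : (kk : ℤ) - K = k') :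
    (3 * (q : ℝ) ^ 2) ^ e * (hcpSumLoopI p q K e M kk (2 * K + 1) : ℝ) / M ≤ layerSum e ((p : ℝ) / q) k' := by
  have hc : (0 : ℝ) < (p : ℝ) / q := by positivity
  have h1 := (hLC.1 e p q K M kk hp hq hM).1
  have h2 := ((hLC.2 e he _ hc k').2.1 K hK).1
  rw [hk'] at h1
  linarith

/-- `layerSum 3 (k p/10⁴) 1 ≤ obHi3N p k`. [folklore] -/
theorem layerSum_le_obHi3N {p k : ℕ} (hp : 0 < p) (hk : 0 < k) :
    layerSum 3 (((k * p : ℕ) : ℝ) / 10000) 1 ≤ (obHi3N p k : ℝ) := by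
  have h := layerSum_le_cert hLC (e := 3) (p := k * p) (q := 10000) (K := 10) (M := 10 ^ 50) (kk := 11)
    (k' := 1) (by norm_num) (Nat.mul_pos hk hp) (by norm_num) (by norm_num) (by norm_num) (by norm_num)
  calc layerSum 3 (((k * p : ℕ) : ℝ) / 10000) 1
      = layerSum 3 (((k * p : ℕ) : ℝ) / ((10000 : ℕ) : ℝ)) 1 := by norm_num
    _ ≤ _ := h
    _ = (obHi3N p k : ℝ) := by
        unfold obHi3N obFS3N
        rw [Rat.cast_add, cast_layerTailQ]
        push_cast
        norm_num

/-- `obLo6N p k ≤ layerSum 6 (k p/10⁴) 1`. [folklore] -/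
theorem obLo6N_le_layerSum {p k : ℕ} (hp : 0 < p) (hk : 0 < k) :
    (obLo6N p k : ℝ) ≤ layerSum 6 (((k * p : ℕ) : ℝ) / 10000) 1 := by
  have h := cert_le_layerSum hLC (e := 6) (p := k * p) (q := 10000) (K := 10) (M := 10 ^ 85) (kk := 11)
    (k' := 1) (by norm_num) (Nat.mul_pos hk hp) (by norm_num) (by norm_num) (by norm_num) (by norm_num)
  calc (obLo6N p k : ℝ)
      = _ := by
        unfold obLo6N obFS6N
        push_cast
        norm_num
    _ ≤ _ := h
    _ = layerSum 6 (((k * p : ℕ) : ℝ) / 10000) 1 := by norm_num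

/-- `layerSum 3 (k p/(2·10⁴)) 2 ≤ obHi3A p k`. [folklore] -/
theorem layerSum_le_obHi3A {p k : ℕ} (hp : 0 < p) (hk : 0 < k) :
    layerSum 3 (((k * p : ℕ) : ℝ) / 20000) 2 ≤ (obHi3A p k : ℝ) := by
  have h := layerSum_le_cert hLC (e := 3) (p := k * p) (q := 20000) (K := 10) (M := 10 ^ 50) (kk := 12)
    (k' := 2) (by norm_num) (Nat.mul_pos hk hp) (by norm_num) (by norm_num) (by norm_num) (by norm_num)
  calc layerSum 3 (((k * p : ℕ) : ℝ) / 20000) 2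
      = layerSum 3 (((k * p : ℕ) : ℝ) / ((20000 : ℕ) : ℝ)) 2 := by norm_num
    _ ≤ _ := h
    _ = (obHi3A p k : ℝ) := by
        unfold obHi3A obFS3A
        rw [Rat.cast_add, cast_layerTailQ]
        push_cast
        norm_num
        ring_nf

/-- `obLo3A p k ≤ layerSum 3 (k p/(2·10⁴)) 2`. [folklore] -/
theorem obLo3A_le_layerSum {p k : ℕ} (hp : 0 < p) (hk : 0 < k) :
    (obLo3A p k : ℝ) ≤ layerSum 3 (((k * p : ℕ) : ℝ) / 20000) 2 := by
  have h := cert_le_layerSum hLC (e := 3) (p := k * p) (q := 20000) (K := 10) (M := 10 ^ 50) (kk := 12)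
    (k' := 2) (by norm_num) (Nat.mul_pos hk hp) (by norm_num) (by norm_num) (by norm_num) (by norm_num)
  calc (obLo3A p k : ℝ)
      = _ := by
        unfold obLo3A obFS3A
        push_cast
        norm_num
    _ ≤ _ := h
    _ = layerSum 3 (((k * p : ℕ) : ℝ) / 20000) 2 := by norm_num

/-- `obLo6A p k ≤ layerSum 6 (k p/(2·10⁴)) 2`. [folklore] -/
theorem obLo6A_le_layerSum {p k : ℕ} (hp : 0 < p) (hk : 0 < k) :
    (obLo6A p k : ℝ) ≤ layerSum 6 (((k * p : ℕ) : ℝ) / 20000) 2 := by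
  have h := cert_le_layerSum hLC (e := 6) (p := k * p) (q := 20000) (K := 10) (M := 10 ^ 85) (kk := 12)
    (k' := 2) (by norm_num) (Nat.mul_pos hk hp) (by norm_num) (by norm_num) (by norm_num) (by norm_num)
  calc (obLo6A p k : ℝ)
      = _ := by
        unfold obLo6A obFS6A
        push_cast
        norm_num
    _ ≤ _ := h
    _ = layerSum 6 (((k * p : ℕ) : ℝ) / 20000) 2 := by norm_num

/-- `layerSum 6 (k p/(2·10⁴)) 2 ≤ obHi6A p k`. [folklore] -/
theorem layerSum_le_obHi6A {p k : ℕ} (hp : 0 < p) (hk : 0 < k) :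
    layerSum 6 (((k * p : ℕ) : ℝ) / 20000) 2 ≤ (obHi6A p k : ℝ) := by
  have h := layerSum_le_cert hLC (e := 6) (p := k * p) (q := 20000) (K := 10) (M := 10 ^ 85) (kk := 12)
    (k' := 2) (by norm_num) (Nat.mul_pos hk hp) (by norm_num) (by norm_num) (by norm_num) (by norm_num)
  calc layerSum 6 (((k * p : ℕ) : ℝ) / 20000) 2
      = layerSum 6 (((k * p : ℕ) : ℝ) / ((20000 : ℕ) : ℝ)) 2 := by norm_num
    _ ≤ _ := h
    _ = (obHi6A p k : ℝ) := by
        unfold obHi6A obFS6A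
        rw [Rat.cast_add, cast_layerTailQ]
        push_cast
        norm_num
        ring_nf

/-- `layerSum 3 c 0 ≤ obT3hi` (the in-layer sum, any ratio). [folklore] -/
theorem layerSum_le_obT3hi (c : ℝ) : layerSum 3 c 0 ≤ (obT3hi : ℝ) := by
  have h := layerSum_le_cert hLC (e := 3) (p := 1) (q := 1) (K := 10) (M := 10 ^ 50) (kk := 10)
    (k' := 0) (by norm_num) (by norm_num) (by norm_num) (by norm_num) (by norm_num) (by norm_num)
  calc layerSum 3 c 0 = layerSum 3 (((1 : ℕ) : ℝ) / ((1 : ℕ) : ℝ)) 0 := layerSum_inLayer 3 c ▸ (by norm_num)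
    _ ≤ _ := h
    _ = (obT3hi : ℝ) := by
        unfold obT3hi obFS3T
        rw [Rat.cast_add, cast_layerTailQ]
        push_cast
        norm_num

/-- `obT6lo ≤ layerSum 6 c 0`. [folklore] -/
theorem obT6lo_le_layerSum (c : ℝ) : (obT6lo : ℝ) ≤ layerSum 6 c 0 := by
  have h := cert_le_layerSum hLC (e := 6) (p := 1) (q := 1) (K := 10) (M := 10 ^ 85) (kk := 10)
    (k' := 0) (by norm_num) (by norm_num) (by norm_num) (by norm_num) (by norm_num) (by norm_num)
  calc (obT6lo : ℝ)
      = _ := by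
        unfold obT6lo obFS6T
        push_cast
        norm_num
    _ ≤ _ := h
    _ = layerSum 6 c 0 := by rw [layerSum_inLayer 6 c]; norm_num

/-! ## The interval aggregates -/

/-- **`offBoxB 12 c ≤ obBhi p₁ p₂` on `c ∈ [p₁, p₂]/10⁴`** (`0 < p₁`). [folklore] -/
theorem offBoxB_le_obBhi {p₁ p₂ : ℕ} (hp₁ : 0 < p₁) {c : ℝ} (h₁ : (p₁ : ℝ) / 10000 ≤ c)
    (h₂ : c ≤ (p₂ : ℝ) / 10000) : offBoxB 12 c ≤ (obBhi p₁ p₂ : ℝ) := by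
  have hc₁ : (0 : ℝ) < (p₁ : ℝ) / 10000 := by positivity
  have hc : 0 < c := hc₁.trans_le h₁
  have hp₂r : (0 : ℝ) < p₂ := by
    have : (0 : ℝ) < (p₂ : ℝ) / 10000 := hc.trans_le h₂
    linarith
  have hp₂ : 0 < p₂ := by exact_mod_cast hp₂r
  unfold offBoxB obBhi
  rw [obBsum_eq_twelve]
  push_cast
  rw [cast_farTail3Q]
  push_cast
  -- in-layer
  have hT := layerSum_le_obT3hi hLC c
  -- layer 1
  have hN1 : layerSum 3 c 1 ≤ (obHi3N p₁ 1 : ℝ) := by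
    have h := layerSum_le_obHi3N hLC hp₁ Nat.one_pos
    have hanti := (hLC.2 3 (by norm_num) _ hc₁ 1).2.2 c h₁
    rw [show (((1 * p₁ : ℕ) : ℝ)) / 10000 = (p₁ : ℝ) / 10000 by push_cast; ring] at h
    exact hanti.trans h
  -- layers 2 … 12
  have hsum : ∑ k ∈ Icc (2 : ℕ) 12, max (layerSum 3 ((k : ℝ) * c / 2) 2)
      (2 * layerSum 3 ((k : ℝ) * c) 1 - layerSum 3 ((k : ℝ) * c / 2) 2) ≤
      ∑ k ∈ Icc (2 : ℕ) 12, ((max (obHi3A p₁ k) (2 * obHi3N p₁ k - obLo3A p₂ k) : ℚ) : ℝ) := by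
    refine Finset.sum_le_sum fun k hk => ?_
    rw [Finset.mem_Icc] at hk
    have hk0 : 0 < k := by omega
    have hkr : (0 : ℝ) < k := by exact_mod_cast hk0
    push_cast
    -- the three certified layer bounds, transported along antitonicity
    have hA_hi : layerSum 3 ((k : ℝ) * c / 2) 2 ≤ (obHi3A p₁ k : ℝ) := by
      have h := layerSum_le_obHi3A hLC hp₁ hk0
      have hc' : (0 : ℝ) < ((k * p₁ : ℕ) : ℝ) / 20000 := by positivity
      have hle : ((k * p₁ : ℕ) : ℝ) / 20000 ≤ (k : ℝ) * c / 2 := by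
        push_cast; nlinarith
      exact ((hLC.2 3 (by norm_num) _ hc' 2).2.2 _ hle).trans h
    have hN_hi : layerSum 3 ((k : ℝ) * c) 1 ≤ (obHi3N p₁ k : ℝ) := by
      have h := layerSum_le_obHi3N hLC hp₁ hk0
      have hc' : (0 : ℝ) < ((k * p₁ : ℕ) : ℝ) / 10000 := by positivity
      have hle : ((k * p₁ : ℕ) : ℝ) / 10000 ≤ (k : ℝ) * c := by
        push_cast; nlinarith
      exact ((hLC.2 3 (by norm_num) _ hc' 1).2.2 _ hle).trans h
    have hA_lo : (obLo3A p₂ k : ℝ) ≤ layerSum 3 ((k : ℝ) * c / 2) 2 := by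
      have h := obLo3A_le_layerSum hLC hp₂ hk0
      have hc' : (0 : ℝ) < (k : ℝ) * c / 2 := by positivity
      have hle : (k : ℝ) * c / 2 ≤ ((k * p₂ : ℕ) : ℝ) / 20000 := by
        push_cast; nlinarith
      exact h.trans ((hLC.2 3 (by norm_num) _ hc' 2).2.2 _ hle)
    exact max_le_max hA_hi (by linarith)
  -- far tail
  have hF := farTail3_anti (K := 12) (by norm_num) hc₁ h₁
  push_cast at hsum
  linarith

/-- **`obAlo p₁ p₂ ≤ offBoxA 12 c` on `c ∈ [p₁, p₂]/10⁴`** (`0 < p₁`). [folklore] -/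
theorem obAlo_le_offBoxA {p₁ p₂ : ℕ} (hp₁ : 0 < p₁) {c : ℝ} (h₁ : (p₁ : ℝ) / 10000 ≤ c)
    (h₂ : c ≤ (p₂ : ℝ) / 10000) : (obAlo p₁ p₂ : ℝ) ≤ offBoxA 12 c := by
  have hc₁ : (0 : ℝ) < (p₁ : ℝ) / 10000 := by positivity
  have hc : 0 < c := hc₁.trans_le h₁
  have hp₂r : (0 : ℝ) < p₂ := by
    have : (0 : ℝ) < (p₂ : ℝ) / 10000 := hc.trans_le h₂
    linarith
  have hp₂ : 0 < p₂ := by exact_mod_cast hp₂r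
  unfold offBoxA obAlo
  rw [obAsum_eq_twelve]
  push_cast
  rw [cast_farTail6Q]
  push_cast
  have hT := obT6lo_le_layerSum hLC c
  have hN1 : (obLo6N p₂ 1 : ℝ) ≤ layerSum 6 c 1 := by
    have h := obLo6N_le_layerSum hLC hp₂ Nat.one_pos
    have hanti := (hLC.2 6 (by norm_num) c hc 1).2.2 ((p₂ : ℝ) / 10000) h₂
    rw [show (((1 * p₂ : ℕ) : ℝ)) / 10000 = (p₂ : ℝ) / 10000 by push_cast; ring] at h
    exact h.trans hanti
  have hsum : ∑ k ∈ Icc (2 : ℕ) 12, ((min (obLo6A p₂ k) (2 * obLo6N p₂ k - obHi6A p₁ k) : ℚ) : ℝ) ≤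
      ∑ k ∈ Icc (2 : ℕ) 12, min (layerSum 6 ((k : ℝ) * c / 2) 2)
        (2 * layerSum 6 ((k : ℝ) * c) 1 - layerSum 6 ((k : ℝ) * c / 2) 2) := by
    refine Finset.sum_le_sum fun k hk => ?_
    rw [Finset.mem_Icc] at hk
    have hk0 : 0 < k := by omega
    have hkr : (0 : ℝ) < k := by exact_mod_cast hk0
    push_cast
    have hA_lo : (obLo6A p₂ k : ℝ) ≤ layerSum 6 ((k : ℝ) * c / 2) 2 := by
      have h := obLo6A_le_layerSum hLC hp₂ hk0
      have hc' : (0 : ℝ) < (k : ℝ) * c / 2 := by positivity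
      have hle : (k : ℝ) * c / 2 ≤ ((k * p₂ : ℕ) : ℝ) / 20000 := by
        push_cast; nlinarith
      exact h.trans ((hLC.2 6 (by norm_num) _ hc' 2).2.2 _ hle)
    have hN_lo : (obLo6N p₂ k : ℝ) ≤ layerSum 6 ((k : ℝ) * c) 1 := by
      have h := obLo6N_le_layerSum hLC hp₂ hk0
      have hc' : (0 : ℝ) < (k : ℝ) * c := by positivity
      have hle : (k : ℝ) * c ≤ ((k * p₂ : ℕ) : ℝ) / 10000 := by
        push_cast; nlinarith
      exact h.trans ((hLC.2 6 (by norm_num) _ hc' 1).2.2 _ hle)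
    have hA_hi : layerSum 6 ((k : ℝ) * c / 2) 2 ≤ (obHi6A p₁ k : ℝ) := by
      have h := layerSum_le_obHi6A hLC hp₁ hk0
      have hc' : (0 : ℝ) < ((k * p₁ : ℕ) : ℝ) / 20000 := by positivity
      have hle : ((k * p₁ : ℕ) : ℝ) / 20000 ≤ (k : ℝ) * c / 2 := by
        push_cast; nlinarith
      exact ((hLC.2 6 (by norm_num) _ hc' 2).2.2 _ hle).trans h
    exact min_le_min hA_lo (by linarith)
  have hF := farTail6_anti (K := 12) (by norm_num) hc₁ h₁
  push_cast at hsum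
  linarith

end Cert

end Summit.AtomisticToContinuum.Crystallization.Theorems.SquareWellLayerCake.StackingFaultSparsity

end
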